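import Summits.HodgeConjecture.HodgeConjecture.Theorems.SignSymmetricPowersFourFactsTorus
import Summits.HodgeConjecture.HodgeConjecture.Theorems.SignSymmetricPowersConfluenceLinkGN
import HarnessLib

/-!
# Crux K1-B `VeryGeneralSignCommutatorsInHg` and the rung leaf modulo {hpg3∕PG, hPL, hCDK, hN}: the `A₃` binder reduced to
# NON-COMMUTATION (phase «N-ONLY» of programme B2PL-SPLIT)

Prover seat `hodge-nonav-19716-p2` (g9), cell `hodge-nonav`; helper `--supports stmt-HodgeConjecture-19716`; sorry-free, no definition, no
new named fact.  VERBATIM port of `SignSymmetricPowersFourFactsTorus` (`signPencilOrbitData_torus` … `signThreefoldPowersHodge_of_genusBound_three_facts`)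
with the binder hB2 = `picardLefschetz_symmetricA3` REPLACED by hN — for every symmetric `A₃` datum (`n, d ≥ 1`) and every bifurcation datum, on some
radius, THE rational transports along the two circles do not commute (`SymmetricA3NonCommutation`, guarded inline) — through
`SignSymmetricPowersConfluenceLinkGN.signConfluenceLinkG_of_nonComm` (bifurcation half = theorem of B2-BIF; Picard–Lefschetz pair data from hPL;
link from non-orthogonality, `exists_link_of_conjugate_confluence_of_ne`).  All theorem names carry the suffix `_N`.

* `veryGeneralSignCommutatorsInHg_of_genusBound_three_facts_N (hpg3) (hPL) (hCDK) (hNC)` — **K1-B ⟸ {hpg3 (landed), hPL, hCDK, hN}**;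
* `signThreefoldPowersHodge_of_genusBound_three_facts_N` — the rung-F-H1 leaf likewise.

Registry consequence (P3's call): 19716 v22 = {hPL, hCDK, hN} — hN is strictly weaker than v20's hA3g (`SymmetricA3MonodromyRelations.nonComm`) and than
hB2 (`picardLefschetz_symmetricA3.exists_nonComm_braid`).  CONDITIONAL; nothing here says HC ∕ HC_AV is proved; rung F-H1 not moved.
-/

noncomputable section

set_option linter.dupNamespace false
set_option linter.unusedVariables false
set_option maxHeartbeats 800000

namespace Summit.HodgeConjecture.HodgeConjecture.Theorems.SignSymmetricPowersFourFactsN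

open Literature.AlgebraicGeometry.Motives Literature.AlgebraicGeometry.HodgeTheory
open Literature.AlgebraicGeometry.HodgeTheory.BettiUniverse
open Literature.AlgebraicTopology.SingularHomology
open CategoryTheory
open Summit.HodgeConjecture.HodgeConjecture.Theorems.SignSymmetricPowersConfluenceLinkG (isSupportedOn_of_coeff_odd_eq_zero)
open Summit.HodgeConjecture.HodgeConjecture.Theorems.SignSymmetricPowersPencilOrbitData
open Summit.HodgeConjecture.HodgeConjecture.Theorems.SignSymmetricPowersSevenFacts
open Literature.AlgebraicGeometry.FundamentalGroup (affineHypersurfaceComplement_meridians_normalClosure_eq_top_holds)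
open Summit.HodgeConjecture.HodgeConjecture.Theorems.SignSymmetricPowersFourFactsGeometricGenus

open Literature.AlgebraicGeometry.Motives Literature.AlgebraicGeometry.Motives.UniversalHypersurface Literature.AlgebraicGeometry.HodgeTheory Literature.AlgebraicGeometry.HodgeTheory.UniversalHypersurface Literature.AlgebraicGeometry.HodgeTheory.BettiUniverse CategoryTheory.Limits in
/-- (NOINV supplied UNCONDITIONALLY by `SignSymmetricPowersNoInvariantsTorus.signNoInvariants`; otherwise verbatim `SignSymmetricPowersSevenFacts.signPencilOrbitData_of_facts_qp` without its binder `hGIC`.) **The GEO statement `SignPencilOrbitData` with ONE extra recorded clause: the total space `𝒳 = 𝒴_M` is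
QUASI-PROJECTIVE** (`isQuasiProjectiveOver_totalM`) — otherwise verbatim `signPencilOrbitData_of_facts` (same proof, same
witness `familyM ℂ 3 d M_ι`), so that the Hodge-generic monodromy THEOREM
`deligne_finiteIndex_monodromy_le_mumfordTateGroup_of_isQuasiProjectiveOver` applies to the envelope's family. -/
theorem signPencilOrbitData_torus_N (hNC : ∀ (n d : ℕ) (f₁ g₀ g₂ : MvPolynomial (Fin (n + 2)) ℂ) (j k : Fin (n + 2)) (a : Fin (n + 2) → ℂˣ),
      1 ≤ n → 1 ≤ d → f₁.IsHomogeneous d → g₀.IsHomogeneous d → g₂.IsHomogeneous d → Literature.AlgebraicGeometry.HodgeTheory.IsSymmetricA3Datum f₁ g₀ g₂ j k a →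
      ∀ (εa εb : ℝ) (ψ : ℂ → ℂ), Literature.AlgebraicGeometry.HodgeTheory.IsSymmetricA3Bifurcation f₁ g₀ g₂ j a εa εb ψ →
        ∃ εa' : ℝ, 0 < εa' ∧ εa' ≤ εa ∧ Literature.AlgebraicGeometry.HodgeTheory.SymmetricA3NonCommutation n d f₁ g₀ g₂ ψ εa')
    (hMC : Literature.AlgebraicGeometry.FundamentalGroup.affineHypersurfaceComplement_meridian_isConj)
    (hZvK : Literature.AlgebraicGeometry.FundamentalGroup.affineHypersurfaceComplement_meridians_normalClosure_eq_top)
    (hPL : picardLefschetz_nodalForms_uniform)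
    (hD0 : (∀ (n d : ℕ), 2 ≤ d → ∃ Disc : MvPolynomial (Literature.AlgebraicGeometry.Motives.UniversalHypersurface.DegIndex n d) ℂ, Irreducible Disc ∧ Disc.IsHomogeneous Disc.totalDegree ∧ 0 < Disc.totalDegree ∧ ∀ a : Literature.AlgebraicGeometry.Motives.UniversalHypersurface.DegIndex n d → ℂ, a ∈ Literature.AlgebraicGeometry.HodgeTheory.singularCoeffs n d ↔ MvPolynomial.eval a Disc = 0)) (hD1 : discriminant_localBranches_nodal) (hNodal : ∀ ⦃d : ℕ⦄, Even d → 4 ≤ d → (∃ f : MvPolynomial (Fin 5) ℂ, f.IsHomogeneous d ∧ (∀ e : Fin 5 →₀ ℕ, ¬ Even (e 0 + e 1) → f.coeff e = 0) ∧ Literature.AlgebraicGeometry.HodgeTheory.IsNodalFormWithNodes f ![(![0, 0, 0, 0, 1] : Fin 5 → ℂ)]) ∧ (∃ f : MvPolynomial (Fin 5) ℂ, f.IsHomogeneous d ∧ (∀ e : Fin 5 →₀ ℕ, ¬ Even (e 0 + e 1) → f.coeff e = 0) ∧ Literature.AlgebraicGeometry.HodgeTheory.IsNodalFormWithNodes f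 ![(![1, 0, 0, 0, 0] : Fin 5 → ℂ)]) ∧ (∃ f : MvPolynomial (Fin 5) ℂ, f.IsHomogeneous d ∧ (∀ e : Fin 5 →₀ ℕ, ¬ Even (e 0 + e 1) → f.coeff e = 0) ∧ Literature.AlgebraicGeometry.HodgeTheory.IsNodalFormWithNodes f ![(![1, 0, 1, 0, 0] : Fin 5 → ℂ), ![-1, 0, 1, 0, 0]])) :
    open Literature.AlgebraicGeometry.Motives Literature.AlgebraicGeometry.HodgeTheory Literature.AlgebraicGeometry.HodgeTheory.BettiUniverse CategoryTheory.Limits in ∀ ⦃d : ℕ⦄, Even d → 4 ≤ d → ∃ (𝒳 S : SchemeOver ℂ) (u : 𝒳 ⟶ S) (hu : IsSmoothProjectiveFamily u 3) (_ : IsQuasiProjectiveOver 𝒳) (_ : IsQuasiProjectiveOver S) (_ : AlgebraicGeometry.Smooth S.hom) (_ : IrreducibleSpace S.left) (hU : IsCohomologicallyLocallyTrivialOn u (Set.univ : Set (ComplexPoints S))) (A : ∀ t : ComplexPoints S, HodgeModel 3 (fiberOver u t)) (hA : ∀ t, (A t).IsHodgeSymmetric) (hfin : ∀ t : ComplexPoints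 S, Module.Finite ℚ (bettiCohomology (fiberOver u t) 3)) (pt : MvPolynomial (Fin 5) ℂ → ComplexPoints S), (∀ W : Set (ComplexPoints S), IsZariskiClosedOnPoints S W → W ≠ Set.univ → ∃ G : MvPolynomial {e : Fin 5 →₀ ℕ // e.degree = d} ℂ, (∃ f : MvPolynomial (Fin 5) ℂ, f.IsHomogeneous d ∧ (∀ e : Fin 5 →₀ ℕ, ¬ Even (e 0 + e 1) → f.coeff e = 0) ∧ MvPolynomial.eval (fun e : {e : Fin 5 →₀ ℕ // e.degree = d} => f.coeff e.1) G ≠ 0) ∧ ∀ f : MvPolynomial (Fin 5) ℂ, f.IsHomogeneous d → (∀ e : Fin 5 →₀ ℕ, ¬ Even (e 0 + e 1) → f.coeff e = 0) → IsSmoothProjective 3 (SmoothHypersurface.hypersurface f) → MvPolynomial.eval (fun e : {e : Fin 5 →₀ ℕ // e.degree = d} => f.coeff e.1) G ≠ 0 → pt f ∉ W) ∧ (∀ f : MvPolynomial (Fin 5) ℂ, f.IsHomogeneous d → (∀ e : Fin 5 →₀ ℕ, ¬ Even (e 0 + e 1) → f.coeff e = 0) → SmoothHypersurface.IsNonsingularForm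 ℂ f → ∀ (hXF : IsSmoothProjective 3 (SmoothHypersurface.hypersurface f)) (ha : (fun i : Fin 5 => if (i : ℕ) < 2 then (-1 : ℂˣ) else 1) ∈ diagonalStabilizer f), ∃ (φ : bettiCohomology (fiberOver u (pt f)) 3 ≃ₗ[ℚ] bettiCohomology (SmoothHypersurface.hypersurface f) 3) (B : LinearMap.BilinForm ℚ (bettiCohomology (fiberOver u (pt f)) 3)) (hB : B.IsAlt) (_ : B.Nondegenerate) (τ : bettiCohomology (fiberOver u (pt f)) 3 →ₗ[ℚ] bettiCohomology (fiberOver u (pt f)) 3) (_ : τ ^ 2 = 1) (rP rL δ₀ : bettiCohomology (fiberOver u (pt f)) 3) (c₁ c₂ c₃ : ℚ) (E : Set (bettiCohomology (fiberOver u (pt f)) 3 ≃ₗ[ℚ] bettiCohomology (fiberOver u (pt f)) 3)), let Γ := (haveI := hfin (pt f); ratMonodromyGroup u 3 hU ⟨pt f, Set.mem_univ _⟩); Nontrivial (bettiCohomology (fiberOver u (pt f)) 3) ∧ (∀ x y, B (τ x) (τ y) = B x y) ∧ (∀ x, φ (τ x) = pull (diagonalAut f ha) 3 (φ x)) ∧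 (∀ x y, B x y = tr hXF (3 + 3) (cup (SmoothHypersurface.hypersurface f) 3 3 (φ x) (φ y))) ∧ (haveI : HodgeTensorFacts.{0, 0} := hodgeTensorFacts_holds; haveI := finite hXF 3; haveI := hfin (pt f); ∀ k : bettiCohomology (fiberOver u (pt f)) 3 ≃ₗ[ℚ] bettiCohomology (fiberOver u (pt f)) 3, k ∈ ((A (pt f)).hodgeStructure (hu.isSmoothProjective (pt f)) (hA (pt f)) 3).hodgeGroup → (φ.symm.trans k).trans φ ∈ (hodge exists_isReal_hodgeModel_holds hXF 3).hodgeGroup) ∧ (∀ g ∈ Γ, ∀ x, g (τ x) = τ (g x)) ∧ (∀ g ∈ Γ, ∀ x y, B (g x) (g y) = B x y) ∧ τ rP = rP ∧ τ rL = -rL ∧ B δ₀ (τ δ₀) = 0 ∧ c₁ ≠ 0 ∧ c₂ ≠ 0 ∧ c₃ ≠ 0 ∧ oneParamTransvectionEquiv B (hB rP) c₁ ∈ Γ ∧ oneParamTransvectionEquiv B (hB rL) c₂ ∈ Γ ∧ oneParamTransvectionEquiv B (hB δ₀) c₃ * oneParamTransvectionEquiv B (hB (τ δ₀)) c₃ ∈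 Γ ∧ Γ = Subgroup.closure E ∧ (∀ e ∈ E, ∃ g ∈ Γ, e = g * oneParamTransvectionEquiv B (hB rP) c₁ * g⁻¹ ∨ e = g * oneParamTransvectionEquiv B (hB rL) c₂ * g⁻¹ ∨ e = g * (oneParamTransvectionEquiv B (hB δ₀) c₃ * oneParamTransvectionEquiv B (hB (τ δ₀)) c₃) * g⁻¹) ∧ (∀ x : bettiCohomology (fiberOver u (pt f)) 3, (∀ g ∈ Γ, g x = x) → x = 0) ∧ (∃ g ∈ Γ, B rP (g δ₀) ≠ 0) ∧ (∃ g ∈ Γ, B rL (g δ₀) ≠ 0)) := by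
  classical
  intro d hd h4d
  obtain ⟨hirr, ⟨t₀⟩, hγ, A, hA, hFIBt⟩ := Summit.HodgeConjecture.HodgeConjecture.Theorems.SignSymmetricPowersFibreCoreB.stub_signFibreCoreC hd h4d
  have hu : IsSmoothProjectiveFamily (familyM ℂ 3 d {m : DegIndex 3 d | Even (m.1 0 + m.1 1)}) 3 := isSmoothProjectiveFamily_familyM ℂ 3 d {m : DegIndex 3 d | Even (m.1 0 + m.1 1)} (by decide) (le_trans (by decide) h4d)
  refine ⟨totalM ℂ 3 d {m : DegIndex 3 d | Even (m.1 0 + m.1 1)}, baseM ℂ 3 d {m : DegIndex 3 d | Even (m.1 0 + m.1 1)}, (familyM ℂ 3 d {m : DegIndex 3 d | Even (m.1 0 + m.1 1)}), hu,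
    isQuasiProjectiveOver_totalM ℂ 3 d {m : DegIndex 3 d | Even (m.1 0 + m.1 1)} (lt_of_lt_of_le (by decide) h4d), isQuasiProjectiveOver_baseM 3 d {m : DegIndex 3 d | Even (m.1 0 + m.1 1)},
    smooth_baseM_hom ℂ 3 d {m : DegIndex 3 d | Even (m.1 0 + m.1 1)}, hirr, isCohomologicallyLocallyTrivialOn_familyM 3 d {m : DegIndex 3 d | Even (m.1 0 + m.1 1)} (by decide) (le_trans (by decide) h4d), A, hA,
    fun s => finite (hu.isSmoothProjective s) 3, classifyingPoint ℂ 3 d {m : DegIndex 3 d | Even (m.1 0 + m.1 1)} t₀, ?_, ?_⟩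
  · -- ALG avoidance: landed `alg_baseM_classifyingPoint`
    intro W hW hW'
    obtain ⟨G, ⟨f, hf, hMf, hG⟩, hall⟩ := alg_baseM_classifyingPoint ℂ 3 d {m : DegIndex 3 d | Even (m.1 0 + m.1 1)} t₀ W hW hW'
    exact ⟨G, ⟨f, hf, coeff_odd_eq_zero_of_isSupportedOn hf hMf, hG⟩,
      fun f hf hev _ hG => (hall f hf (isSupportedOn_of_coeff_odd_eq_zero hev) hG).2⟩
  · intro f hf hev hJ hXF ha
    have hMf := isSupportedOn_of_coeff_odd_eq_zero (d := d) hev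
    have hY : IsSmoothProjective 3 (fiberOver (familyM ℂ 3 d {m : DegIndex 3 d | Even (m.1 0 + m.1 1)}) (classifyingPoint ℂ 3 d {m : DegIndex 3 d | Even (m.1 0 + m.1 1)} t₀ f)) := hu.isSmoothProjective _
    have hF := hFIBt hγ t₀ f hf hMf hJ
    have hF := hF hXF ha
    obtain ⟨hBn, hτ2, hτB, hΓτ, hΓB, φ, hφτ, ⟨c, hc, hφB⟩, hHG⟩ := hF
    -- no Γ-invariants: the NOINV piece at the base point (stepwise application through the `let`-telescope)
    have hN := Summit.HodgeConjecture.HodgeConjecture.Theorems.SignSymmetricPowersNoInvariantsTorus.signNoInvariants hd h4d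
    have hGIC' := hN (classifyingPoint ℂ 3 d {m : DegIndex 3 d | Even (m.1 0 + m.1 1)} t₀ f)
    obtain ⟨⟨f₁, hf₁, hev₁, hn₁⟩, ⟨f₂, hf₂, hev₂, hn₂⟩, ⟨f₃, hf₃, hev₃, hn₃⟩⟩ := hNodal hd h4d
    have hM₁ := isSupportedOn_of_coeff_odd_eq_zero (d := d) hev₁
    have hM₂ := isSupportedOn_of_coeff_odd_eq_zero (d := d) hev₂
    have hM₃ := isSupportedOn_of_coeff_odd_eq_zero (d := d) hev₃
    -- (piece applications are made stepwise: one-shot elaboration of the long `let`-telescopes times out)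
    have hG := Summit.HodgeConjecture.HodgeConjecture.Theorems.SignSymmetricPowersMeridianGeneration.stub_signMeridianGeneration hZvK hPL hD0 hD1 hd h4d
    have hG := hG hγ t₀ f hf hMf hJ
    have hG := hG f₁ f₂ f₃
    have hG := hG hf₁ hM₁ hn₁
    have hG := hG hf₂ hM₂ hn₂
    have hG := hG hf₃ hM₃ hn₃
    obtain ⟨g₁, g₂, g₃, hg₁, hMg₁, hgp₁, hg₂, hMg₂, hgp₂, hg₃, hMg₃, hgp₃, ε₁, hε₁, hGENε⟩ := hG
    have hP := Summit.HodgeConjecture.HodgeConjecture.Theorems.SignSymmetricPowersPencilTransvections.stub_signPencilTransvections hPL hd h4d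
    have hP := hP hγ t₀ f hf hMf hJ
    obtain ⟨hPP, hPN, hP2⟩ := hP
    have hPP := hPP f₁ g₁ hf₁ hg₁
    have hPP := hPP hM₁ hMg₁ hn₁ hgp₁
    obtain ⟨εP, hεP, hPPε⟩ := hPP
    have hPN := hPN f₂ g₂ hf₂ hg₂
    have hPN := hPN hM₂ hMg₂ hn₂ hgp₂
    obtain ⟨εL, hεL, hPLε⟩ := hPN
    have hP2 := hP2 f₃ g₃ hf₃ hg₃
    have hP2 := hP2 hM₃ hMg₃ hn₃ hgp₃
    obtain ⟨εD, hεD, hP2ε⟩ := hP2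
    have hK := (Summit.HodgeConjecture.HodgeConjecture.Theorems.SignSymmetricPowersConfluenceLinkGN.signConfluenceLinkG_of_nonComm hD0 hNC hMC hD1 hPL) hd h4d
    have hK := hK hγ t₀ f hf hMf hJ
    have hK := hK hτ2 hτB hΓτ hΓB
    have hK₁ := hK ![0, 0, 0, 0, 1] (Or.inl rfl) f₁ g₁ hf₁ hg₁
    have hK₁ := hK₁ hM₁ hMg₁ hn₁ hgp₁ f₃ g₃ hf₃ hg₃
    have hK₁ := hK₁ hM₃ hMg₃ hn₃ hgp₃
    obtain ⟨εK, hεK, hKε⟩ := hK₁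
    have hK₂ := hK ![1, 0, 0, 0, 0] (Or.inr rfl) f₂ g₂ hf₂ hg₂
    have hK₂ := hK₂ hM₂ hMg₂ hn₂ hgp₂ f₃ g₃ hf₃ hg₃
    have hK₂ := hK₂ hM₃ hMg₃ hn₃ hgp₃
    obtain ⟨εK', hεK', hK'ε⟩ := hK₂
    -- a common radius below the six bounds
    have hm : 0 < min (min (min ε₁ εP) (min εL εD)) (min εK εK') :=
      lt_min (lt_min (lt_min hε₁ hεP) (lt_min hεL hεD)) (lt_min hεK hεK')
    have hε : 0 < min (min (min ε₁ εP) (min εL εD)) (min εK εK') / 2 := half_pos hm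
    have hεm : min (min (min ε₁ εP) (min εL εD)) (min εK εK') / 2 < min (min (min ε₁ εP) (min εL εD)) (min εK εK') :=
      half_lt_self hm
    have h₁ := hεm.trans_le ((min_le_left _ _).trans ((min_le_left _ _).trans (min_le_left _ _)))
    have h₂ := hεm.trans_le ((min_le_left _ _).trans ((min_le_left _ _).trans (min_le_right _ _)))
    have h₃ := hεm.trans_le ((min_le_left _ _).trans ((min_le_right _ _).trans (min_le_left _ _)))
    have h₄ := hεm.trans_le ((min_le_left _ _).trans ((min_le_right _ _).trans (min_le_right _ _)))
    have h₅ := hεm.trans_le ((min_le_right _ _).trans (min_le_left _ _))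
    have h₆ := hεm.trans_le ((min_le_right _ _).trans (min_le_right _ _))
    have hGENε := hGENε _ hε h₁
    obtain ⟨s₁, s₂, s₃, β₁, β₂, β₃, ω₁, ω₂, ω₃, T₁, T₂, T₃, E, hs₁, hω₁, hs₂, hω₂, hs₃, hω₃, hT₁, hT₂, hT₃, hΓE, hE⟩ := hGENε
    have hPPε := hPPε _ hε h₂ s₁ β₁ ω₁
    have hPPε := hPPε hs₁ hω₁ T₁ hT₁
    obtain ⟨rP, c₁, hrP0, hc₁, hτrP, hT₁eq⟩ := hPPε
    have hPLε := hPLε _ hε h₃ s₂ β₂ ω₂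
    have hPLε := hPLε hs₂ hω₂ T₂ hT₂
    obtain ⟨rL, c₂, hrL0, hc₂, hτrL, hT₂eq⟩ := hPLε
    have hP2ε := hP2ε _ hε h₄ s₃ β₃ ω₃
    have hP2ε := hP2ε hs₃ hω₃ T₃ hT₃
    obtain ⟨δ₀, c₃, hδ0, hδ0', hc₃, hBδτ, hT₃eq⟩ := hP2ε
    have hKε := hKε _ _ hε h₅ hε h₅ s₁ β₁ ω₁
    have hKε := hKε hs₁ hω₁ s₃ β₃ ω₃
    have hKε := hKε hs₃ hω₃ T₁ hT₁ T₃ hT₃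
    have hKε := hKε rP δ₀ c₁ c₃ hrP0 hδ0 hδ0' (Or.inl hτrP) hBδτ
    have hKε := hKε hT₁eq hT₃eq
    obtain ⟨gP, hgP, hlinkP⟩ := hKε
    have hK'ε := hK'ε _ _ hε h₆ hε h₆ s₂ β₂ ω₂
    have hK'ε := hK'ε hs₂ hω₂ s₃ β₃ ω₃
    have hK'ε := hK'ε hs₃ hω₃ T₂ hT₂ T₃ hT₃
    have hK'ε := hK'ε rL δ₀ c₂ c₃ hrL0 hδ0 hδ0' (Or.inr hτrL) hBδτ
    have hK'ε := hK'ε hT₂eq hT₃eq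
    obtain ⟨gL, hgL, hlinkL⟩ := hK'ε
    subst hT₁eq hT₂eq hT₃eq
    -- v12d seam (FIB-coreC: `B = c · φ^*B_{X_f}`, `c ≠ 0` opaque): GEO's form is `c⁻¹ • B`, the transvection parameters become `cᵢ * c`
    have e₁ := oneParamTransvectionEquiv_inv_smul _ hrP0 hc c₁
    have e₂ := oneParamTransvectionEquiv_inv_smul _ hrL0 hc c₂
    have e₃ := oneParamTransvectionEquiv_inv_smul _ hδ0 hc c₃
    have e₃' := oneParamTransvectionEquiv_inv_smul _ hδ0' hc c₃
    simp only [← e₁, ← e₂, ← e₃, ← e₃'] at hT₁ hT₂ hT₃ hE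
    refine ⟨φ, _, isAlt_smul_form (isAlt_tr_cup_of_odd hY ⟨1, by norm_num⟩) c⁻¹, nondegenerate_smul_form hBn (inv_ne_zero hc), _, hτ2,
      rP, rL, δ₀, c₁ * c, c₂ * c, c₃ * c, E, ?_⟩
    intro Γ
    -- `H³ ≠ 0`: LINK gives `B rP (gP δ₀) ≠ 0`, so `rP ≠ 0`
    have hNon : Nontrivial (bettiCohomology (fiberOver (familyM ℂ 3 d {m : DegIndex 3 d | Even (m.1 0 + m.1 1)}) (classifyingPoint ℂ 3 d {m : DegIndex 3 d | Even (m.1 0 + m.1 1)} t₀ f)) 3) :=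
      nontrivial_of_ne rP 0 fun h0 => hlinkP (by simp only [h0, map_zero, LinearMap.zero_apply])
    exact ⟨hNon, smul_form_invariant hτB c⁻¹, hφτ, inv_smul_form_eq hc hφB, hHG, hΓτ, smul_form_invariant_subgroup hΓB c⁻¹, hτrP, hτrL,
      smul_form_apply_eq_zero hBδτ c⁻¹, mul_ne_zero hc₁ hc, mul_ne_zero hc₂ hc, mul_ne_zero hc₃ hc, ⟨_, hT₁⟩, ⟨_, hT₂⟩, ⟨_, hT₃⟩, hΓE, hE,
      hGIC', ⟨gP, hgP, inv_smul_form_apply_ne_zero hlinkP hc⟩, ⟨gL, hgL, inv_smul_form_apply_ne_zero hlinkL hc⟩⟩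

/-- (GIC-free variant: NOINV from `signNoInvariants`; otherwise verbatim `signPencilEnvelope_of_facts_qp`.) (Quasi-projective variant, verbatim port.) **The sign-pencil ENVELOPE of skeleton v12f from the landed GEO pieces and the landed orbit-data algebra** (port of the
skeleton's sorry-free seam `signPencilEnvelope_of_orbitData`, with `signPencilOrbitDataF_of_facts`, the tree theorem F-DISC-0,
`stub_signNodalForms` and `stub_signOrbitData` substituted), modulo the six facts GEO consumes. -/
theorem signPencilEnvelope_torus_N (hZvK : Literature.AlgebraicGeometry.FundamentalGroup.affineHypersurfaceComplement_meridians_normalClosure_eq_top)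
    (hPL : Literature.AlgebraicGeometry.HodgeTheory.picardLefschetz_nodalForms_uniform)
    (hD1 : Literature.AlgebraicGeometry.HodgeTheory.discriminant_localBranches_nodal) (hNC : ∀ (n d : ℕ) (f₁ g₀ g₂ : MvPolynomial (Fin (n + 2)) ℂ) (j k : Fin (n + 2)) (a : Fin (n + 2) → ℂˣ),
      1 ≤ n → 1 ≤ d → f₁.IsHomogeneous d → g₀.IsHomogeneous d → g₂.IsHomogeneous d → Literature.AlgebraicGeometry.HodgeTheory.IsSymmetricA3Datum f₁ g₀ g₂ j k a →
      ∀ (εa εb : ℝ) (ψ : ℂ → ℂ), Literature.AlgebraicGeometry.HodgeTheory.IsSymmetricA3Bifurcation f₁ g₀ g₂ j a εa εb ψ →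
        ∃ εa' : ℝ, 0 < εa' ∧ εa' ≤ εa ∧ Literature.AlgebraicGeometry.HodgeTheory.SymmetricA3NonCommutation n d f₁ g₀ g₂ ψ εa')
    (hMC : Literature.AlgebraicGeometry.FundamentalGroup.affineHypersurfaceComplement_meridian_isConj) :
    open Literature.AlgebraicGeometry.Motives Literature.AlgebraicGeometry.HodgeTheory Literature.AlgebraicGeometry.HodgeTheory.BettiUniverse CategoryTheory.Limits in ∀ ⦃d : ℕ⦄, Even d → 4 ≤ d → ∃ (𝒳 S : SchemeOver ℂ) (u : 𝒳 ⟶ S) (hu : IsSmoothProjectiveFamily u 3) (_ : IsQuasiProjectiveOver 𝒳) (_ : IsQuasiProjectiveOver S) (_ : AlgebraicGeometry.Smooth S.hom) (_ : IrreducibleSpace S.left) (hU : IsCohomologicallyLocallyTrivialOn u (Set.univ : Set (ComplexPoints S))) (A : ∀ t : ComplexPoints S, HodgeModel 3 (fiberOver u t)) (hA : ∀ t, (A t).IsHodgeSymmetric) (hfin : ∀ t : ComplexPoints S, Module.Finite ℚ (bettiCohomology (fiberOver u t) 3)) (pt : MvPolynomial (Fin 5) ℂ → ComplexPoints S), (∀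 W : Set (ComplexPoints S), IsZariskiClosedOnPoints S W → W ≠ Set.univ → ∃ G : MvPolynomial {e : Fin 5 →₀ ℕ // e.degree = d} ℂ, (∃ f : MvPolynomial (Fin 5) ℂ, f.IsHomogeneous d ∧ (∀ e : Fin 5 →₀ ℕ, ¬ Even (e 0 + e 1) → f.coeff e = 0) ∧ MvPolynomial.eval (fun e : {e : Fin 5 →₀ ℕ // e.degree = d} => f.coeff e.1) G ≠ 0) ∧ ∀ f : MvPolynomial (Fin 5) ℂ, f.IsHomogeneous d → (∀ e : Fin 5 →₀ ℕ, ¬ Even (e 0 + e 1) → f.coeff e = 0) → IsSmoothProjective 3 (SmoothHypersurface.hypersurface f) → MvPolynomial.eval (fun e : {e : Fin 5 →₀ ℕ // e.degree = d} => f.coeff e.1) G ≠ 0 → pt f ∉ W) ∧ (∀ f : MvPolynomial (Fin 5) ℂ, f.IsHomogeneous d → (∀ e : Fin 5 →₀ ℕ, ¬ Even (e 0 + e 1) → f.coeff e = 0) → SmoothHypersurface.IsNonsingularForm ℂ f → ∀ (hXF : IsSmoothProjective 3 (SmoothHypersurface.hypersurface f)) (ha : (fun i : Fin 5 => if (i :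 ℕ) < 2 then (-1 : ℂˣ) else 1) ∈ diagonalStabilizer f), ∃ (φ : bettiCohomology (fiberOver u (pt f)) 3 ≃ₗ[ℚ] bettiCohomology (SmoothHypersurface.hypersurface f) 3) (B : LinearMap.BilinForm ℚ (bettiCohomology (fiberOver u (pt f)) 3)) (hB : B.IsAlt) (_ : B.Nondegenerate) (τ : bettiCohomology (fiberOver u (pt f)) 3 →ₗ[ℚ] bettiCohomology (fiberOver u (pt f)) 3) (_ : τ ^ 2 = 1) (T D : Set (bettiCohomology (fiberOver u (pt f)) 3)), let Γ := (haveI := hfin (pt f); ratMonodromyGroup u 3 hU ⟨pt f, Set.mem_univ _⟩); let RP : Set (bettiCohomology (fiberOver u (pt f)) 3) := {r ∈ T | τ r = r} ∪ (fun δ => δ + τ δ) '' D; let RN : Set (bettiCohomology (fiberOver u (pt f)) 3) := {r ∈ T | τ r = -r} ∪ (fun δ => δ - τ δ) '' D; Nontrivial (bettiCohomology (fiberOver u (pt f)) 3) ∧ (∀ x y, B (τ x) (τ y) = B x y) ∧ (∀ x, φ (τ x) = pull (diagonalAut f ha) 3 (φ x)) ∧ (∀ x y, B x y = tr hXF (3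 + 3) (cup (SmoothHypersurface.hypersurface f) 3 3 (φ x) (φ y))) ∧ (haveI : HodgeTensorFacts.{0, 0} := hodgeTensorFacts_holds; haveI := finite hXF 3; haveI := hfin (pt f); ∀ k : bettiCohomology (fiberOver u (pt f)) 3 ≃ₗ[ℚ] bettiCohomology (fiberOver u (pt f)) 3, k ∈ ((A (pt f)).hodgeStructure (hu.isSmoothProjective (pt f)) (hA (pt f)) 3).hodgeGroup → (φ.symm.trans k).trans φ ∈ (hodge exists_isReal_hodgeModel_holds hXF 3).hodgeGroup) ∧ (∀ r ∈ T, ∃ c : ℚ, c ≠ 0 ∧ oneParamTransvectionEquiv B (hB r) c ∈ Γ) ∧ (∀ δ ∈ D, B δ (τ δ) = 0 ∧ ∃ c : ℚ, c ≠ 0 ∧ oneParamTransvectionEquiv B (hB δ) c * oneParamTransvectionEquiv B (hB (τ δ)) c ∈ Γ) ∧ Submodule.span ℚ RP = Module.End.eigenspace τ 1 ∧ (∀ A' ⊆ RP, A'.Nonempty → A' ≠ RP → ∃ r ∈ A', ∃ ρ ∈ RP, ρ ∉ A' ∧ B r ρ ≠ 0) ∧ (RP.Nonempty → ∃ r ∈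 T, τ r = r) ∧ Submodule.span ℚ RN = Module.End.eigenspace τ (-1) ∧ (∀ A' ⊆ RN, A'.Nonempty → A' ≠ RN → ∃ r ∈ A', ∃ ρ ∈ RN, ρ ∉ A' ∧ B r ρ ≠ 0) ∧ (RN.Nonempty → ∃ r ∈ T, τ r = -r)) := by
  intro d hd h4d
  obtain ⟨𝒳, S, u, hu, h𝒳, hqp, hsm, hirr, hU, A, hA, hfin, pt, hALG, hMEM⟩ := (signPencilOrbitData_torus_N hNC hMC hZvK hPL
      (fun n d hd => Literature.AlgebraicGeometry.HodgeTheory.exists_irreducible_isHomogeneous_discriminantForm (n := n) (d := d) hd) hD1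
      Summit.HodgeConjecture.HodgeConjecture.Theorems.SignSymmetricPowersNodalForms.stub_signNodalForms) hd h4d
  refine ⟨𝒳, S, u, hu, h𝒳, hqp, hsm, hirr, hU, A, hA, hfin, pt, hALG, ?_⟩
  intro f hf hev hJ hXF ha
  obtain ⟨φ, B, hB, hBn, τ, hτ, rP, rL, δ₀, c₁, c₂, c₃, E, hNon, hτB, hφτ, hφB, hHG, hΓτ, hΓB, hrP, hrL, hδ₀,
    hc₁, hc₂, hc₃, huP, huL, huδ, hΓE, hE, hinv, hlinkP, hlinkL⟩ := hMEM f hf hev hJ hXF ha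
  haveI := hfin (pt f)
  obtain ⟨h6, h7, h8, h9, h10, h11, h12, h13⟩ :=
    Summit.HodgeConjecture.HodgeConjecture.Theorems.SignSymmetricPowersSignOrbitData.stub_signOrbitData _ B hB hBn τ hτ hτB _ hΓτ hΓB rP rL δ₀ c₁ c₂ c₃ E hrP hrL hδ₀ hc₁ hc₂ hc₃ huP huL huδ hΓE hE hinv
      hlinkP hlinkL
  exact ⟨φ, B, hB, hBn, τ, hτ, _, _, hNon, hτB, hφτ, hφB, hHG, h6, h7, h8, h9, h10, h11, h12, h13⟩

/-- (GIC-free variant: FIVE named facts; otherwise verbatim `SignSymmetricPowersSevenFactsKernel.veryGeneralSignCommutatorsInHg_of_signDeckHodge`.) **K1-B `VeryGeneralSignCommutatorsInHg` from the deck Hodge numbers and six named facts.**  The hypothesis `hSDH` is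
the registered signature of the stub `stub_signDeckHodge` (the `(−1)^j`-eigen-Hodge numbers `shn d j q` of the sign
involution on `H³` of a very general sign-symmetric threefold of even degree `d ≥ 4`); the rest is the seven-facts proof:
sign-pencil envelope with quasi-projective total space, CDK cover avoided polynomially, Hodge genericity, CMSP 15.3.7 (a
theorem), transport of the `σ`-centraliser to the fibre, `commutator_mem_hodgeGroup_of_signSymmetric`, transport back,
`stub_modelTransfer`.  CONDITIONAL result. [cite: VoisinHodgeII2003, §6.1.3 Thm. 6.10 and Cor. 6.12] -/
theorem veryGeneralSignCommutatorsInHg_of_signDeckHodge_torus_N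
    (hSDH : open Literature.AlgebraicGeometry.Motives Literature.AlgebraicGeometry.HodgeTheory Literature.AlgebraicGeometry.HodgeTheory.BettiUniverse CategoryTheory.Limits in let pmul2 : List (ℕ × ℕ) → List (ℕ × ℕ) → List (ℕ × ℕ) := fun a b => (List.range (a.length + b.length - 1)).map fun k => (((List.range (k + 1)).map fun i => (a.getD i (0, 0)).1 * (b.getD (k - i) (0, 0)).1 + (a.getD i (0, 0)).2 * (b.getD (k - i) (0, 0)).2).sum, ((List.range (k + 1)).map fun i => (a.getD i (0, 0)).1 * (b.getD (k - i) (0, 0)).2 + (a.getD i (0, 0)).2 * (b.getD (k - i) (0, 0)).1).sum); let fac : ℕ → Bool → List (ℕ × ℕ) := fun d odd => (List.range (d - 1)).map fun k => if odd ∧ ¬ Even k then (0, 1) else (1, 0); let shn : ℕ → ℕ → ℕ → ℕ := fun d j q => if (q + 1) * d < 5 then 0 else if j = 0 then (([fac d true, fac d false, fac d false, fac d false].foldl pmul2 (fac d true)).getD ((q + 1) * d - 5) (0, 0)).1 else (([fac d true, fac d false, fac d false, fac d false].foldl pmul2 (fac d true)).getD ((q + 1) * d - 5) (0, 0)).2;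 ∀ ⦃d : ℕ⦄, Even d → 4 ≤ d → ∀ f : MvPolynomial (Fin 5) ℂ, f.IsHomogeneous d → (∀ e : Fin 5 →₀ ℕ, ¬ Even (e 0 + e 1) → f.coeff e = 0) → SmoothHypersurface.IsNonsingularForm ℂ f → ∀ (hXF : IsSmoothProjective 3 (SmoothHypersurface.hypersurface f)) (ha : (fun i : Fin 5 => if (i : ℕ) < 2 then (-1 : ℂˣ) else 1) ∈ diagonalStabilizer f), ∀ j q : ℕ, j < 2 → q ≤ 3 → Module.finrank ℂ ↥(Module.End.eigenspace ((pull (diagonalAut f ha) 3).baseChange ℂ) ((-1 : ℂ) ^ j) ⊓ (hodge exists_isReal_hodgeModel_holds hXF 3).piece ((3 : ℤ) - q) q) = shn d j q)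
    (hZvK : Literature.AlgebraicGeometry.FundamentalGroup.affineHypersurfaceComplement_meridians_normalClosure_eq_top)
    (hPL : Literature.AlgebraicGeometry.HodgeTheory.picardLefschetz_nodalForms_uniform)
    (hD1 : Literature.AlgebraicGeometry.HodgeTheory.discriminant_localBranches_nodal)
    (hCDK : Literature.AlgebraicGeometry.HodgeTheory.cmsp_nonHodgeGenericPoints_countable_algebraic_cover)
    (hNC : ∀ (n d : ℕ) (f₁ g₀ g₂ : MvPolynomial (Fin (n + 2)) ℂ) (j k : Fin (n + 2)) (a : Fin (n + 2) → ℂˣ),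
      1 ≤ n → 1 ≤ d → f₁.IsHomogeneous d → g₀.IsHomogeneous d → g₂.IsHomogeneous d → Literature.AlgebraicGeometry.HodgeTheory.IsSymmetricA3Datum f₁ g₀ g₂ j k a →
      ∀ (εa εb : ℝ) (ψ : ℂ → ℂ), Literature.AlgebraicGeometry.HodgeTheory.IsSymmetricA3Bifurcation f₁ g₀ g₂ j a εa εb ψ →
        ∃ εa' : ℝ, 0 < εa' ∧ εa' ≤ εa ∧ Literature.AlgebraicGeometry.HodgeTheory.SymmetricA3NonCommutation n d f₁ g₀ g₂ ψ εa') :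
    Summit.HodgeConjecture.HodgeConjecture.Theses.SignSymmetricPowers.VeryGeneralSignCommutatorsInHg := by
  have hMC : Literature.AlgebraicGeometry.FundamentalGroup.affineHypersurfaceComplement_meridian_isConj :=
    Literature.AlgebraicGeometry.FundamentalGroup.affineHypersurfaceComplement_meridian_isConj_holds
  refine Summit.HodgeConjecture.HodgeConjecture.Theorems.SignSymmetricPowersModelTransfer.stub_modelTransfer ?_
  intro d hd h4d
  obtain ⟨𝒳, S, u, hu, h𝒳, hqp, hsm, hirr, hU, A, hA, hfin, pt, hALG, hMEM⟩ :=
    signPencilEnvelope_torus_N hZvK hPL hD1 hNC hMC hd h4d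
  haveI hHTF : HodgeTensorFacts.{0, 0} := hodgeTensorFacts_holds
  haveI : ∀ t : ComplexPoints S, Module.Finite ℚ (bettiCohomology (fiberOver u t) 3) := hfin
  -- the Cattani–Deligne–Kaplan cover of the non-Hodge-generic points of the base
  obtain ⟨W, hW, hcov⟩ := hCDK u 3 3 hu hqp hsm hirr hU A hA
  -- each member of the cover is avoided off one nonzero polynomial condition on the ι-even coefficients
  choose G hG₀ hG using fun j => hALG (W j) (hW j).1 (hW j).2
  -- v5: prepend the nonsingular-avoidance polynomial `g₀`, so that very general members are NONSINGULAR FORMS (this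
  -- excludes the degenerate corners `f = c·G^k`, `k ≥ 2`, where `V₊(f)_red` is a smooth threefold of lower degree)
  obtain ⟨g₀, hg₀, hNSg⟩ := Summit.HodgeConjecture.HodgeConjecture.Theorems.SignSymmetricPowersNonsingularAvoidance.stub_signNonsingularAvoidance hd h4d
  refine ⟨fun i => if i = 0 then g₀ else G (i - 1), ?_, ?_⟩
  · intro i
    by_cases hi : i = 0
    · simpa only [hi, if_true] using hg₀
    · simpa only [hi, if_false] using hG₀ (i - 1)
  intro f hf hev hgen' hXF ha
  have hJ : SmoothHypersurface.IsNonsingularForm ℂ f := hNSg f hf (by simpa only [if_true] using hgen' 0)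
  have hgen : ∀ j, MvPolynomial.eval (fun e : {e : Fin 5 →₀ ℕ // e.degree = d} => f.coeff e.1) (G j) ≠ 0 := fun j => by
    simpa only [Nat.succ_ne_zero, if_false, Nat.add_sub_cancel] using hgen' (j + 1)
  -- Deck clauses: `σ_f^{*2} = 1` and `σ_f^*` a `tr ∘ cup` isometry (tree), and the deck Hodge numbers from `hSDH`
  obtain ⟨ha', h1, h2⟩ := exists_signDeckModel_clauses_one_two f hev hXF
  refine ⟨⟨h1, h2, hSDH hd h4d f hf hev hJ hXF ha'⟩, ?_⟩
  intro g h hg hh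
  obtain ⟨φ, B, hB, hBn, τ, hτ, T, D, hNon, hτB, hφτ, hφB, hHG, hT, hD, hspanPos, hconnPos,
    hseedPos, hspanNeg, hconnNeg, hseedNeg⟩ := hMEM f hf hev hJ hXF ha
  haveI := finite hXF 3
  haveI : Nontrivial (bettiCohomology (fiberOver u (pt f)) 3) := hNon
  -- the classifying point of a very general member is Hodge generic
  have hsgen : IsHodgeGenericPoint u 3 hU hu A hA ⟨pt f, Set.mem_univ _⟩ := by
    by_contra hns
    obtain ⟨j, hj⟩ := hcov ⟨pt f, Set.mem_univ _⟩ hns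
    exact hG j f hf hev hXF (hgen j) hj
  -- CMSP 15.3.7 (ii), now a THEOREM (quasi-projective total space, irreducible base): the algebraic monodromy group
  -- `Mon⁰ = (Γ^Zar)⁰` lies in the Mumford–Tate group of the fibre
  have hΓ : glIdentityComponent (ratMonodromyGroup u 3 hU ⟨pt f, Set.mem_univ _⟩) ⊆
      (((A (pt f)).hodgeStructure (hu.isSmoothProjective (pt f)) (hA (pt f)) 3).mumfordTateGroup : Set (bettiCohomology (fiberOver u (pt f)) 3 ≃ₗ[ℚ] bettiCohomology (fiberOver u (pt f)) 3)) :=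
    (deligne_finiteIndex_monodromy_le_mumfordTateGroup_of_isQuasiProjectiveOver u 3 3 hu h𝒳 hqp hsm hirr hU A hA
      ⟨pt f, Set.mem_univ _⟩ hsgen).2
  -- transport the two σ-centraliser isometries to the fibre
  have hστ : ∀ y, τ (φ.symm y) = φ.symm (pull (diagonalAut f ha) 3 y) := fun y => by
    apply φ.injective
    rw [hφτ, LinearEquiv.apply_symm_apply, LinearEquiv.apply_symm_apply]
  have cenτ : ∀ k : bettiCohomology (SmoothHypersurface.hypersurface f) 3 ≃ₗ[ℚ] bettiCohomology (SmoothHypersurface.hypersurface f) 3,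
      (∀ x, k (pull (diagonalAut f ha) 3 x) = pull (diagonalAut f ha) 3 (k x)) →
      ∀ x, ((φ.trans k).trans φ.symm) (τ x) = τ (((φ.trans k).trans φ.symm) x) := by
    intro k hk x
    simp only [LinearEquiv.trans_apply]
    rw [hφτ, hk, hστ]
  have cenB : ∀ k : bettiCohomology (SmoothHypersurface.hypersurface f) 3 ≃ₗ[ℚ] bettiCohomology (SmoothHypersurface.hypersurface f) 3,
      (∀ x y, tr hXF (3 + 3) (cup (SmoothHypersurface.hypersurface f) 3 3 (k x) (k y)) = tr hXF (3 + 3) (cup (SmoothHypersurface.hypersurface f) 3 3 x y)) →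
      ∀ x y, B (((φ.trans k).trans φ.symm) x) (((φ.trans k).trans φ.symm) y) = B x y := by
    intro k hk x y
    simp only [LinearEquiv.trans_apply]
    rw [hφB, LinearEquiv.apply_symm_apply, LinearEquiv.apply_symm_apply, hk, ← hφB]
  -- Theorem A's algebra (landed): commutators of the sign-symmetric centraliser of the fibre lie in its Hodge group
  have hcomm := commutator_mem_hodgeGroup_of_signSymmetric ((A (pt f)).hodgeStructure (hu.isSmoothProjective (pt f)) (hA (pt f)) 3)
    (smoothProjective_hodgeStructure_isPolarizable_holds (hu.isSmoothProjective (pt f)) (A (pt f))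
      (hA (pt f)) 3) ⟨1, by norm_num⟩ hB hBn hτ hτB hΓ hT hD hspanPos hconnPos hseedPos hspanNeg hconnNeg
    hseedNeg (cenτ g hg.1) (cenB g hg.2) (cenτ h hh.1) (cenB h hh.2)
  -- transport back to `H³(X_f;ℚ)` along `φ` (Hodge groups correspond)
  have hback := hHG _ hcomm
  have hid : (φ.symm.trans (((φ.trans g).trans φ.symm) * ((φ.trans h).trans φ.symm) *
      ((φ.trans g).trans φ.symm)⁻¹ * ((φ.trans h).trans φ.symm)⁻¹)).trans φ = g * h * g⁻¹ * h⁻¹ := by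
    have hinv : ∀ k : bettiCohomology (SmoothHypersurface.hypersurface f) 3 ≃ₗ[ℚ] bettiCohomology (SmoothHypersurface.hypersurface f) 3,
        ((φ.trans k).trans φ.symm)⁻¹ = (φ.trans k⁻¹).trans φ.symm := by
      intro k
      rw [inv_eq_iff_mul_eq_one]
      ext x
      simp
    rw [hinv, hinv]
    ext x
    simp
  rw [hid] at hback
  exact hback

/-- **Crux K1-B `VeryGeneralSignCommutatorsInHg` modulo {`h^{3,0} ≤ C(d−1,4)` (inlined), hPL, hCDK, hNC}** — h423 DISCHARGED: the
GIC-free kernel composition fed `signDeckHodge_of_genusBound hpg3`, with ZvK and the nodal local branches of the discriminant supplied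
by their tree theorems. CONDITIONAL; nothing here says HC ∕ HC_AV is proved. [cite: Arapura2012, §17.3 (17.3.1)]
[cite: VoisinHodgeII2003, §6.1.3 Cor. 6.12] [cite: CattaniDeligneKaplan1995, Thm. 1.1 and Cor. 1.2] -/
theorem veryGeneralSignCommutatorsInHg_of_genusBound_three_facts_N
    (hpg3 : ∀ ⦃d : ℕ⦄ (f : MvPolynomial (Fin 5) ℂ), f.IsHomogeneous d → SmoothHypersurface.IsNonsingularForm ℂ f →
      ∀ (hXF : IsSmoothProjective 3 (SmoothHypersurface.hypersurface f)),
        Module.finrank ℂ ↥((BettiUniverse.hodge exists_isReal_hodgeModel_holds hXF 3).piece 3 0) ≤ (d - 1).choose 4)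
    (hPL : Literature.AlgebraicGeometry.HodgeTheory.picardLefschetz_nodalForms_uniform)
    (hCDK : Literature.AlgebraicGeometry.HodgeTheory.cmsp_nonHodgeGenericPoints_countable_algebraic_cover)
    (hNC : ∀ (n d : ℕ) (f₁ g₀ g₂ : MvPolynomial (Fin (n + 2)) ℂ) (j k : Fin (n + 2)) (a : Fin (n + 2) → ℂˣ),
      1 ≤ n → 1 ≤ d → f₁.IsHomogeneous d → g₀.IsHomogeneous d → g₂.IsHomogeneous d → Literature.AlgebraicGeometry.HodgeTheory.IsSymmetricA3Datum f₁ g₀ g₂ j k a →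
      ∀ (εa εb : ℝ) (ψ : ℂ → ℂ), Literature.AlgebraicGeometry.HodgeTheory.IsSymmetricA3Bifurcation f₁ g₀ g₂ j a εa εb ψ →
        ∃ εa' : ℝ, 0 < εa' ∧ εa' ≤ εa ∧ Literature.AlgebraicGeometry.HodgeTheory.SymmetricA3NonCommutation n d f₁ g₀ g₂ ψ εa') :
    Summit.HodgeConjecture.HodgeConjecture.Theses.SignSymmetricPowers.VeryGeneralSignCommutatorsInHg :=
  veryGeneralSignCommutatorsInHg_of_signDeckHodge_torus_N
    (signDeckHodge_of_genusBound hpg3) affineHypersurfaceComplement_meridians_normalClosure_eq_top_holds @hPL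
    discriminant_localBranches_nodal_holds @hCDK @hNC

/-- **Crux K1-B `VeryGeneralSignCommutatorsInHg` modulo {PG, hPL, hCDK, hNC}** (PG = `Arapura2012_hypersurface_geometricGenus`, shared
with K1-A). CONDITIONAL; nothing here says HC ∕ HC_AV is proved. [cite: Arapura2012, §17.3 (17.3.1)]
[cite: VoisinHodgeII2003, §6.1.3 Cor. 6.12] [cite: CattaniDeligneKaplan1995, Thm. 1.1 and Cor. 1.2] -/
theorem veryGeneralSignCommutatorsInHg_of_geometricGenus_three_facts_N
    (hPG : Literature.AlgebraicGeometry.HodgeTheory.Arapura2012_hypersurface_geometricGenus)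
    (hPL : Literature.AlgebraicGeometry.HodgeTheory.picardLefschetz_nodalForms_uniform)
    (hCDK : Literature.AlgebraicGeometry.HodgeTheory.cmsp_nonHodgeGenericPoints_countable_algebraic_cover)
    (hNC : ∀ (n d : ℕ) (f₁ g₀ g₂ : MvPolynomial (Fin (n + 2)) ℂ) (j k : Fin (n + 2)) (a : Fin (n + 2) → ℂˣ),
      1 ≤ n → 1 ≤ d → f₁.IsHomogeneous d → g₀.IsHomogeneous d → g₂.IsHomogeneous d → Literature.AlgebraicGeometry.HodgeTheory.IsSymmetricA3Datum f₁ g₀ g₂ j k a →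
      ∀ (εa εb : ℝ) (ψ : ℂ → ℂ), Literature.AlgebraicGeometry.HodgeTheory.IsSymmetricA3Bifurcation f₁ g₀ g₂ j a εa εb ψ →
        ∃ εa' : ℝ, 0 < εa' ∧ εa' ≤ εa ∧ Literature.AlgebraicGeometry.HodgeTheory.SymmetricA3NonCommutation n d f₁ g₀ g₂ ψ εa') :
    Summit.HodgeConjecture.HodgeConjecture.Theses.SignSymmetricPowers.VeryGeneralSignCommutatorsInHg :=
  veryGeneralSignCommutatorsInHg_of_genusBound_three_facts_N (genusBound_of_geometricGenus hPG) @hPL @hCDK @hNC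

/-- **The rung leaf `SignThreefoldPowersHodge` modulo {PG, hPL, hCDK, hNC}** (composition with the landed
`signThreefoldPowersHodge_of_veryGeneralSignCommutatorsInHg`). CONDITIONAL; rung F-H1 not moved. [cite: Arapura2012, §17.3 (17.3.1)]
[cite: CattaniDeligneKaplan1995, Thm. 1.1 and Cor. 1.2] -/
theorem signThreefoldPowersHodge_of_geometricGenus_three_facts_N
    (hPG : Literature.AlgebraicGeometry.HodgeTheory.Arapura2012_hypersurface_geometricGenus)
    (hPL : Literature.AlgebraicGeometry.HodgeTheory.picardLefschetz_nodalForms_uniform)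
    (hCDK : Literature.AlgebraicGeometry.HodgeTheory.cmsp_nonHodgeGenericPoints_countable_algebraic_cover)
    (hNC : ∀ (n d : ℕ) (f₁ g₀ g₂ : MvPolynomial (Fin (n + 2)) ℂ) (j k : Fin (n + 2)) (a : Fin (n + 2) → ℂˣ),
      1 ≤ n → 1 ≤ d → f₁.IsHomogeneous d → g₀.IsHomogeneous d → g₂.IsHomogeneous d → Literature.AlgebraicGeometry.HodgeTheory.IsSymmetricA3Datum f₁ g₀ g₂ j k a →
      ∀ (εa εb : ℝ) (ψ : ℂ → ℂ), Literature.AlgebraicGeometry.HodgeTheory.IsSymmetricA3Bifurcation f₁ g₀ g₂ j a εa εb ψ →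
        ∃ εa' : ℝ, 0 < εa' ∧ εa' ≤ εa ∧ Literature.AlgebraicGeometry.HodgeTheory.SymmetricA3NonCommutation n d f₁ g₀ g₂ ψ εa') :
    Summit.HodgeConjecture.HodgeConjecture.Theses.SignSymmetricPowers.SignThreefoldPowersHodge :=
  SignSymmetricPowersSignThreefoldPowersHodge.signThreefoldPowersHodge_of_veryGeneralSignCommutatorsInHg
    (veryGeneralSignCommutatorsInHg_of_geometricGenus_three_facts_N @hPG @hPL @hCDK @hNC)

/-- The same rung leaf modulo {`h^{3,0} ≤ C(d−1,4)` (inlined), hPL, hCDK, hNC}. CONDITIONAL; rung F-H1 not moved.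
[cite: Arapura2012, §17.3 (17.3.1)] [cite: CattaniDeligneKaplan1995, Thm. 1.1 and Cor. 1.2] -/
theorem signThreefoldPowersHodge_of_genusBound_three_facts_N
    (hpg3 : ∀ ⦃d : ℕ⦄ (f : MvPolynomial (Fin 5) ℂ), f.IsHomogeneous d → SmoothHypersurface.IsNonsingularForm ℂ f →
      ∀ (hXF : IsSmoothProjective 3 (SmoothHypersurface.hypersurface f)),
        Module.finrank ℂ ↥((BettiUniverse.hodge exists_isReal_hodgeModel_holds hXF 3).piece 3 0) ≤ (d - 1).choose 4)
    (hPL : Literature.AlgebraicGeometry.HodgeTheory.picardLefschetz_nodalForms_uniform)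
    (hCDK : Literature.AlgebraicGeometry.HodgeTheory.cmsp_nonHodgeGenericPoints_countable_algebraic_cover)
    (hNC : ∀ (n d : ℕ) (f₁ g₀ g₂ : MvPolynomial (Fin (n + 2)) ℂ) (j k : Fin (n + 2)) (a : Fin (n + 2) → ℂˣ),
      1 ≤ n → 1 ≤ d → f₁.IsHomogeneous d → g₀.IsHomogeneous d → g₂.IsHomogeneous d → Literature.AlgebraicGeometry.HodgeTheory.IsSymmetricA3Datum f₁ g₀ g₂ j k a →
      ∀ (εa εb : ℝ) (ψ : ℂ → ℂ), Literature.AlgebraicGeometry.HodgeTheory.IsSymmetricA3Bifurcation f₁ g₀ g₂ j a εa εb ψ →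
        ∃ εa' : ℝ, 0 < εa' ∧ εa' ≤ εa ∧ Literature.AlgebraicGeometry.HodgeTheory.SymmetricA3NonCommutation n d f₁ g₀ g₂ ψ εa') :
    Summit.HodgeConjecture.HodgeConjecture.Theses.SignSymmetricPowers.SignThreefoldPowersHodge :=
  SignSymmetricPowersSignThreefoldPowersHodge.signThreefoldPowersHodge_of_veryGeneralSignCommutatorsInHg
    (veryGeneralSignCommutatorsInHg_of_genusBound_three_facts_N hpg3 @hPL @hCDK @hNC)

end Summit.HodgeConjecture.HodgeConjecture.Theorems.SignSymmetricPowersFourFactsN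

end
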